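import Summits.CriticalPhenomena.CardyFormulaZ2.Theses.CardyGluingRDE

/-!
# `CardyGluingRDE.BoxMerging` from `GluingContraction` (stmt-CriticalPhenomena-8582, support)

Item `BoxMerging` of route `CardyGluingRDE` (sub-problem `CardyFormulaZ2`) asks that the joint laws
of the `4·2^j`-segment connectivity matrix of a square window merge in total variation between
bond-`ℤ²` and site-`𝕋` percolation at `p = 1/2`:
`∀ δ₀ > 0, ∀ j ε, 0 < ε → ∃ η > 0, ∀ u u' < η, TV_j(u,u') ≤ ε`.
Stand-alone this is the universality of joint boundary-segment laws (an open problem); inside the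
route it is the consumer form of the thesis `GluingContraction` (clauses (A) local contraction of
the multiresolution discrepancy `Dw_K = Σ_{j ≤ K} 2^{-σj} TV_j` under mesh-halving, (B) entry of
the `ℤ²` orbit into the `ρ/2`-ball).

This file proves the reduction `GluingContraction → BoxMerging` (which is, verbatim, the route's
support item `ContractionGivesMerging`, stmt-CriticalPhenomena-8583). The argument is elementary
real analysis (Schramm–Smirnov 2011 §1 for the setting; the iteration is the standard
contraction-with-slack estimate):

* choose `K ≥ j` with slack `C·2^{-κK} ≤ ρ(1-θ)/2` and `2^{σj}·C·2^{-κK}/(1-θ) ≤ ε/6`;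
* along the orbit `(u₀/2^{mn}, b₀/2^{mn})` started in the entry window `u₀ ∈ [u_Z/2^m, u_Z]`,
  `b₀ ∈ (0, δ_T]`, clause (B) and `n` applications of clause (A) give
  `Dw_K ≤ θ^n ρ/2 + C·2^{-κK}/(1-θ)` (the invariant `Dw_K ≤ ρ` is maintained), hence
  `TV_j ≤ 2^{σj} Dw_K ≤ ε/3` for `n ≥ n₀`;
* the windows cover `(0, u_Z/2^{m n₀}]`, and the two meshes are decoupled by the rectangle
  inequality `TV_j(a,b) ≤ TV_j(a,b') + TV_j(a',b') + TV_j(a',b)` with `a' = u_Z/2^{m n₀}` and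
  `b' = δ_T/2^{m n(a)}`.

The core is stated for an abstract family `T j u u'` of nonnegative "discrepancies" satisfying the
rectangle inequality (`BoxMerging_core`); the route statement is obtained by instantiating `T` with
the half-`ℓ¹` distance of the two laws (`BoxMerging_of_GluingContraction`).
-/

namespace Summit.CriticalPhenomena.CardyFormulaZ2.Theorems

open Finset Real
open Summit.CriticalPhenomena.CardyFormulaZ2.Theses.CardyGluingRDE

section Abstract

variable {ι : ℕ → Type*} [∀ j, Fintype (ι j)] (p q : (j : ℕ) → ℝ → ι j → ℝ)

/-- The half-`ℓ¹` discrepancy `½ Σ_M |p_j(u,M) - q_j(u',M)|` between two families of weights is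
nonnegative. [folklore] -/
theorem BoxMerging_tv_nonneg (j : ℕ) (u u' : ℝ) : 0 ≤ 1 / 2 * ∑ M, |p j u M - q j u' M| :=
  mul_nonneg (by norm_num) (sum_nonneg fun _ _ => abs_nonneg _)

/-- Rectangle inequality for the half-`ℓ¹` discrepancy between two families of laws:
`TV(a,b) ≤ TV(a,b') + TV(a',b') + TV(a',b)` (triangle inequality termwise). [folklore] -/
theorem BoxMerging_tv_rect (j : ℕ) (a b a' b' : ℝ) :
    1 / 2 * ∑ M, |p j a M - q j b M| ≤
      1 / 2 * ∑ M, |p j a M - q j b' M| + 1 / 2 * ∑ M, |p j a' M - q j b' M| +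
        1 / 2 * ∑ M, |p j a' M - q j b M| := by
  rw [← mul_add, ← mul_add, ← sum_add_distrib, ← sum_add_distrib]
  refine mul_le_mul_of_nonneg_left (sum_le_sum fun M _ => ?_) (by norm_num)
  have h1 : p j a M - q j b M = (p j a M - q j b' M) - (p j a' M - q j b' M) + (p j a' M - q j b M) := by
    ring
  calc |p j a M - q j b M|
      = |(p j a M - q j b' M) - (p j a' M - q j b' M) + (p j a' M - q j b M)| := by rw [← h1]
    _ ≤ |(p j a M - q j b' M) - (p j a' M - q j b' M)| + |p j a' M - q j b M| := abs_add_le _ _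
    _ ≤ |p j a M - q j b' M| + |p j a' M - q j b' M| + |p j a' M - q j b M| := by
        have := abs_sub (p j a M - q j b' M) (p j a' M - q j b' M)
        linarith

end Abstract

/-- **Merging from contraction, abstract core.** Let `T j u u' ≥ 0` satisfy the rectangle
inequality, and let `Dw_K(u,u') = Σ_{i ≤ K} 2^{-σ i} T i u u'`. If for every `K` there is an onset
`δ_T > 0` with (A) `Dw_K(u/2^m, u'/2^m) ≤ θ·Dw_K(u,u') + C·2^{-κK}` whenever
`0 < u ≤ δ₀/(C 2^K)`, `0 < u' ≤ δ_T`, `Dw_K(u,u') ≤ ρ`, and (B) an entry window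
`[u_Z/2^m, u_Z] × (0, δ_T]` on which `Dw_K ≤ ρ/2`, with `0 ≤ θ < 1`, `C, κ, ρ > 0`, `m ≥ 1`, then
`T j u u' ≤ ε` for all sufficiently small `u, u'`. (Geometric-series iteration of a contraction with
slack; the planner's sketch for `ContractionGivesMerging`.) [folklore] -/
theorem BoxMerging_core {T : ℕ → ℝ → ℝ → ℝ} (hT0 : ∀ i u u', 0 ≤ T i u u')
    (hTr : ∀ i a b a' b', T i a b ≤ T i a b' + T i a' b' + T i a' b)
    {σ θ C κ ρ δ₀ : ℝ} {m : ℕ} (hθ0 : 0 ≤ θ) (hθ1 : θ < 1) (hC : 0 < C) (hκ : 0 < κ) (hρ : 0 < ρ)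
    (hm : 1 ≤ m)
    (hK : ∀ K : ℕ, ∃ δT : ℝ, 0 < δT ∧
      (∀ u u' : ℝ, 0 < u → u ≤ δ₀ / (C * 2 ^ K) → 0 < u' → u' ≤ δT →
        ∑ i ∈ range (K + 1), (2 : ℝ) ^ (-(σ * (i : ℝ))) * T i u u' ≤ ρ →
        ∑ i ∈ range (K + 1), (2 : ℝ) ^ (-(σ * (i : ℝ))) * T i (u / 2 ^ m) (u' / 2 ^ m) ≤
          θ * ∑ i ∈ range (K + 1), (2 : ℝ) ^ (-(σ * (i : ℝ))) * T i u u' +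
            C * (2 : ℝ) ^ (-(κ * (K : ℝ)))) ∧
      (∃ uZ : ℝ, 0 < uZ ∧ uZ ≤ δ₀ / (C * 2 ^ K) ∧ ∀ u u' : ℝ, uZ / 2 ^ m ≤ u → u ≤ uZ →
        0 < u' → u' ≤ δT → ∑ i ∈ range (K + 1), (2 : ℝ) ^ (-(σ * (i : ℝ))) * T i u u' ≤ ρ / 2))
    (j : ℕ) {ε : ℝ} (hε : 0 < ε) :
    ∃ η : ℝ, 0 < η ∧ ∀ u u' : ℝ, 0 < u → u < η → 0 < u' → u' < η → T j u u' ≤ ε := by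
  have h2m1 : (1 : ℝ) < 2 ^ m := one_lt_pow₀ one_lt_two (by omega)
  have h2m0 : (0 : ℝ) < 2 ^ m := by positivity
  have hθ1' : 0 < 1 - θ := sub_pos.2 hθ1
  have h2σ : 0 < (2 : ℝ) ^ (σ * (j : ℝ)) := rpow_pos_of_pos two_pos _
  -- Step 1: a resolution `K ≥ j` with small slack.
  obtain ⟨K, hjK, hK1, hK2⟩ : ∃ K : ℕ, j ≤ K ∧ C * (2 : ℝ) ^ (-(κ * (K : ℝ))) ≤ ρ * (1 - θ) / 2 ∧
      (2 : ℝ) ^ (σ * (j : ℝ)) * (C * (2 : ℝ) ^ (-(κ * (K : ℝ))) / (1 - θ)) ≤ ε / 6 := by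
    have hy0 : 0 < (2 : ℝ) ^ (-κ) := rpow_pos_of_pos two_pos _
    have hy1 : (2 : ℝ) ^ (-κ) < 1 := rpow_lt_one_of_one_lt_of_neg one_lt_two (neg_neg_of_pos hκ)
    have ht : 0 < min (ρ * (1 - θ) / 2 / C) (ε / 6 * (1 - θ) / C / (2 : ℝ) ^ (σ * (j : ℝ))) :=
      lt_min (by positivity) (by positivity)
    obtain ⟨n, hn⟩ := exists_pow_lt_of_lt_one ht hy1
    have hpow : (2 : ℝ) ^ (-(κ * ((max n j : ℕ) : ℝ))) ≤
        min (ρ * (1 - θ) / 2 / C) (ε / 6 * (1 - θ) / C / (2 : ℝ) ^ (σ * (j : ℝ))) := by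
      rw [← neg_mul, rpow_mul zero_le_two, rpow_natCast]
      exact (pow_le_pow_of_le_one hy0.le hy1.le (le_max_left n j)).trans hn.le
    refine ⟨max n j, le_max_right _ _, ?_, ?_⟩
    · calc C * (2 : ℝ) ^ (-(κ * ((max n j : ℕ) : ℝ)))
          ≤ C * (ρ * (1 - θ) / 2 / C) :=
            mul_le_mul_of_nonneg_left (hpow.trans (min_le_left _ _)) hC.le
        _ = ρ * (1 - θ) / 2 := by field_simp
    · calc (2 : ℝ) ^ (σ * (j : ℝ)) * (C * (2 : ℝ) ^ (-(κ * ((max n j : ℕ) : ℝ))) / (1 - θ))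
          ≤ (2 : ℝ) ^ (σ * (j : ℝ)) * (C * (ε / 6 * (1 - θ) / C / (2 : ℝ) ^ (σ * (j : ℝ))) / (1 - θ)) :=
            mul_le_mul_of_nonneg_left (div_le_div_of_nonneg_right
              (mul_le_mul_of_nonneg_left (hpow.trans (min_le_right _ _)) hC.le) hθ1'.le) h2σ.le
        _ = ε / 6 := by field_simp
  -- Step 2: the onset and the entry window at resolution `K`.
  obtain ⟨δT, hδT, hA, uZ, huZ0, huZle, hB⟩ := hK K
  -- Step 3: the slack sum `S = C 2^{-κK} / (1 - θ)` and the number of halvings `n₀`.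
  set S : ℝ := C * (2 : ℝ) ^ (-(κ * (K : ℝ))) / (1 - θ) with hS
  have hc0 : 0 ≤ C * (2 : ℝ) ^ (-(κ * (K : ℝ))) := by positivity
  have hS0 : 0 ≤ S := div_nonneg hc0 hθ1'.le
  have hSρ : S ≤ ρ / 2 := by
    rw [hS, div_le_iff₀ hθ1']
    linarith
  have hSc : C * (2 : ℝ) ^ (-(κ * (K : ℝ))) = (1 - θ) * S := by
    rw [hS]; field_simp
  obtain ⟨n₀, hn₀⟩ : ∃ n₀ : ℕ, (2 : ℝ) ^ (σ * (j : ℝ)) * (θ ^ n₀ * (ρ / 2)) ≤ ε / 6 := by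
    obtain ⟨n₀, h⟩ :=
      exists_pow_lt_of_lt_one (show 0 < ε / 6 / ((2 : ℝ) ^ (σ * (j : ℝ)) * (ρ / 2)) by positivity) hθ1
    refine ⟨n₀, ?_⟩
    rw [lt_div_iff₀ (by positivity)] at h
    linarith
  have hθn1 : ∀ n : ℕ, θ ^ n ≤ 1 := fun n => pow_le_one₀ hθ0 hθ1.le
  -- Step 4: the orbit bound, by induction on the number of halvings.
  have orbit : ∀ (n : ℕ) (u₀ b₀ : ℝ), uZ / 2 ^ m ≤ u₀ → u₀ ≤ uZ → 0 < b₀ → b₀ ≤ δT →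
      ∑ i ∈ range (K + 1), (2 : ℝ) ^ (-(σ * (i : ℝ))) * T i (u₀ / (2 ^ m) ^ n) (b₀ / (2 ^ m) ^ n) ≤
        θ ^ n * (ρ / 2) + S := by
    intro n
    induction n with
    | zero =>
      intro u₀ b₀ h1 h2 h3 h4
      simp only [pow_zero, div_one, one_mul]
      linarith [hB u₀ b₀ h1 h2 h3 h4]
    | succ n ih =>
      intro u₀ b₀ h1 h2 h3 h4
      have hu₀ : 0 < u₀ := lt_of_lt_of_le (div_pos huZ0 h2m0) h1
      have hpn : (1 : ℝ) ≤ (2 ^ m) ^ n := one_le_pow₀ h2m1.le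
      have hpn0 : (0 : ℝ) < (2 ^ m) ^ n := by positivity
      have ih' := ih u₀ b₀ h1 h2 h3 h4
      have hDle : ∑ i ∈ range (K + 1), (2 : ℝ) ^ (-(σ * (i : ℝ))) *
          T i (u₀ / (2 ^ m) ^ n) (b₀ / (2 ^ m) ^ n) ≤ ρ := by
        have : θ ^ n * (ρ / 2) ≤ 1 * (ρ / 2) := mul_le_mul_of_nonneg_right (hθn1 n) (by positivity)
        linarith
      have key := hA (u₀ / (2 ^ m) ^ n) (b₀ / (2 ^ m) ^ n) (div_pos hu₀ hpn0)
        ((div_le_self hu₀.le hpn).trans (h2.trans huZle)) (div_pos h3 hpn0)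
        ((div_le_self h3.le hpn).trans h4) hDle
      rw [div_div, div_div, ← pow_succ] at key
      have hmono := mul_le_mul_of_nonneg_left ih' hθ0
      rw [pow_succ θ n]
      linarith
  -- Step 5: the resolution-`j` discrepancy along the orbit, for `n ≥ n₀` halvings.
  have hTD : ∀ a b : ℝ, T j a b ≤
      (2 : ℝ) ^ (σ * (j : ℝ)) * ∑ i ∈ range (K + 1), (2 : ℝ) ^ (-(σ * (i : ℝ))) * T i a b := by
    intro a b
    have hmem : j ∈ range (K + 1) := mem_range.2 (Nat.lt_succ_of_le hjK)
    have hle := single_le_sum (f := fun i : ℕ => (2 : ℝ) ^ (-(σ * (i : ℝ))) * T i a b)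
      (fun i _ => mul_nonneg (rpow_nonneg zero_le_two _) (hT0 i a b)) hmem
    have hinv : (2 : ℝ) ^ (σ * (j : ℝ)) * (2 : ℝ) ^ (-(σ * (j : ℝ))) = 1 := by
      rw [rpow_neg zero_le_two, mul_inv_cancel₀ h2σ.ne']
    calc T j a b = (2 : ℝ) ^ (σ * (j : ℝ)) * ((2 : ℝ) ^ (-(σ * (j : ℝ))) * T j a b) := by
          rw [← mul_assoc, hinv, one_mul]
      _ ≤ _ := mul_le_mul_of_nonneg_left hle h2σ.le
  have core : ∀ n : ℕ, n₀ ≤ n → ∀ u₀ b₀ : ℝ, uZ / 2 ^ m ≤ u₀ → u₀ ≤ uZ → 0 < b₀ → b₀ ≤ δT →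
      T j (u₀ / (2 ^ m) ^ n) (b₀ / (2 ^ m) ^ n) ≤ ε / 3 := by
    intro n hn u₀ b₀ h1 h2 h3 h4
    have hD := orbit n u₀ b₀ h1 h2 h3 h4
    have h0 := hTD (u₀ / (2 ^ m) ^ n) (b₀ / (2 ^ m) ^ n)
    have hθmono : θ ^ n ≤ θ ^ n₀ := pow_le_pow_of_le_one hθ0 hθ1.le hn
    have h1' : (2 : ℝ) ^ (σ * (j : ℝ)) * (θ ^ n * (ρ / 2)) ≤ ε / 6 := by
      have : θ ^ n * (ρ / 2) ≤ θ ^ n₀ * (ρ / 2) := mul_le_mul_of_nonneg_right hθmono (by positivity)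
      exact (mul_le_mul_of_nonneg_left this h2σ.le).trans hn₀
    have h2' := mul_le_mul_of_nonneg_left hD h2σ.le
    have h3' : (2 : ℝ) ^ (σ * (j : ℝ)) * (θ ^ n * (ρ / 2) + S) =
        (2 : ℝ) ^ (σ * (j : ℝ)) * (θ ^ n * (ρ / 2)) + (2 : ℝ) ^ (σ * (j : ℝ)) * S := mul_add _ _ _
    linarith
  -- Step 6: cover `(0, η)` by windows and decouple the two meshes.
  have hp0 : (0 : ℝ) < (2 ^ m) ^ n₀ := by positivity
  refine ⟨min (uZ / (2 ^ m) ^ n₀) (δT / (2 ^ m) ^ n₀), lt_min (by positivity) (by positivity), ?_⟩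
  intro u u' hu huη hu' hu'η
  have hu1 : u < uZ / (2 ^ m) ^ n₀ := lt_of_lt_of_le huη (min_le_left _ _)
  have hu'1 : u' < δT / (2 ^ m) ^ n₀ := lt_of_lt_of_le hu'η (min_le_right _ _)
  have hx : 1 ≤ uZ / u := by
    rw [le_div_iff₀ hu, one_mul]
    exact (hu1.trans_le (div_le_self huZ0.le (one_le_pow₀ h2m1.le))).le
  obtain ⟨n, hn1, hn2⟩ := exists_nat_pow_near hx h2m1
  have hn₀n : n₀ ≤ n := by
    have h' : ((2 : ℝ) ^ m) ^ n₀ < (2 ^ m) ^ (n + 1) := by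
      refine lt_trans ?_ hn2
      rw [lt_div_iff₀ hu]
      rw [lt_div_iff₀ hp0] at hu1
      linarith
    have := (pow_lt_pow_iff_right₀ h2m1).1 h'
    omega
  have hpn0 : (0 : ℝ) < (2 ^ m) ^ n := by positivity
  have hu₀1 : uZ / 2 ^ m ≤ u * (2 ^ m) ^ n := by
    rw [div_le_iff₀ h2m0]
    rw [div_lt_iff₀ hu, pow_succ] at hn2
    linarith
  have hu₀2 : u * (2 ^ m) ^ n ≤ uZ := by
    rw [le_div_iff₀ hu] at hn1
    linarith
  obtain ⟨d, rfl⟩ := Nat.exists_eq_add_of_le hn₀n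
  have hpd : (0 : ℝ) < (2 ^ m) ^ d := by positivity
  -- the three legs of the rectangle inequality
  have B1 : T j u (δT / (2 ^ m) ^ (n₀ + d)) ≤ ε / 3 := by
    have := core (n₀ + d) hn₀n (u * (2 ^ m) ^ (n₀ + d)) δT hu₀1 hu₀2 hδT le_rfl
    rwa [mul_div_cancel_right₀ _ hpn0.ne'] at this
  have B2 : T j (uZ / (2 ^ m) ^ n₀) (δT / (2 ^ m) ^ (n₀ + d)) ≤ ε / 3 := by
    have := core n₀ le_rfl uZ (δT / (2 ^ m) ^ d) (div_le_self huZ0.le h2m1.le) le_rfl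
      (div_pos hδT hpd) (div_le_self hδT.le (one_le_pow₀ h2m1.le))
    rwa [div_div, ← pow_add, add_comm d n₀] at this
  have B3 : T j (uZ / (2 ^ m) ^ n₀) u' ≤ ε / 3 := by
    have hb : u' * (2 ^ m) ^ n₀ ≤ δT := by
      rw [lt_div_iff₀ hp0] at hu'1
      exact hu'1.le
    have := core n₀ le_rfl uZ (u' * (2 ^ m) ^ n₀) (div_le_self huZ0.le h2m1.le) le_rfl
      (by positivity) hb
    rwa [mul_div_cancel_right₀ _ hp0.ne'] at this
  have := hTr j u u' (uZ / (2 ^ m) ^ n₀) (δT / (2 ^ m) ^ (n₀ + d))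
  linarith

/-- **`GluingContraction → BoxMerging`** (the reduction behind support item
`ContractionGivesMerging`, stmt-CriticalPhenomena-8583, proved here as a helper for
stmt-CriticalPhenomena-8582): if the multiresolution total-variation discrepancy between the
bond-`ℤ²` and site-`𝕋` laws of the square's boundary-segment connectivity matrix contracts under
mesh-halving from the lattice-resolution onset (clause (A)) and the `ℤ²` orbit enters the `ρ/2`-ball
on a full window of meshes (clause (B)), then at every fixed resolution `j` the two laws merge:
`TV_j(u,u') ≤ ε` for all small meshes `u, u'`. Instance of `BoxMerging_core` with
`T j u u' = ½ Σ_M |P_ℤ²(E_Z(M)) - P_𝕋(E_T(M))|`. [folklore] -/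
theorem BoxMerging_of_GluingContraction (hX : GluingContraction) : BoxMerging := by
  unfold GluingContraction at hX
  unfold BoxMerging
  intro PZ PT Sq seg EZ ET TV δ₀ hδ₀ j ε hε
  obtain ⟨σ, θ, C, κ, ρ, m, -, hθ0, hθ1, hC, hκ, hρ, hm, hK⟩ := hX
  exact BoxMerging_core (T := fun i u u' => 1 / 2 * ∑ M, |PZ.real (EZ δ₀ i u M) - PT.real (ET δ₀ i u' M)|)
    (fun i u u' => BoxMerging_tv_nonneg (fun i u M => PZ.real (EZ δ₀ i u M))
      (fun i u' M => PT.real (ET δ₀ i u' M)) i u u')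
    (fun i a b a' b' => BoxMerging_tv_rect (fun i u M => PZ.real (EZ δ₀ i u M))
      (fun i u' M => PT.real (ET δ₀ i u' M)) i a b a' b')
    hθ0 hθ1 hC hκ hρ hm (hK δ₀ hδ₀) j hε

end Summit.CriticalPhenomena.CardyFormulaZ2.Theorems
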